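import Literature.ModelTheory.ExponentialFields.TermExpElimination
import Literature.ModelTheory.ExponentialFields.Wilkie1989Lemma3
import HarnessLib

/-!
# Khovanskii's elimination step for `L_exp`-terms: the auxiliary systems

Topic `Literature/ModelTheory/ExponentialFields`. The term-level constructions of one step of
Khovanskii's induction over the number of exponentials (A. G. Khovanskii, *Fewnomials* (1991),
Ch. III; the form needed for A. J. Wilkie, Illinois J. Math. 33 (1989), §5, Proposition). Given a
square system `F = (F₁, …, F_N)` of terms in parameters `ȳ ∈ ℝᵐ` and unknowns `x̄ ∈ ℝᴺ` and an
exponential subterm `e = exp(s)` of maximal size: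

* `Khovanskii.elimF F e` — **stage 1**: `e` replaced by a new unknown `y = x_{N+1}`
  (`ExpTerm.substExp`), a system of `N` terms in `N + 1` unknowns;
* `Khovanskii.minorSq G` — the sum of the squares of the maximal minors of the Jacobian matrix
  of terms `(∂Gᵣ/∂xⱼ)` of such a system (nonzero exactly where the gradient rows are
  independent);
* `Khovanskii.liftH G = liftSys G (minorSq G)` — **stage 2** (Rabinowitsch): the `N + 1` terms
  `G₁, …, G_N, x_{N+2} · minorSq G - 1` in `N + 2` unknowns, whose real zero set is the regular part
  of the zero set of `G`, made closed;
* `Khovanskii.omegaRow s`, `Khovanskii.contactP G s` — the row of the `1`-form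
  `dy - y ds` and the **contact term** `P = det [∂(liftH G)/∂x̄ ; dy - y ds]`;
* `Khovanskii.rho` — the squared radius `Σ xⱼ²`;
* `Khovanskii.contactSys G s`, `Khovanskii.sphereSys G` — the two square systems in `N + 2`
  unknowns and `m + 1` parameters `(ȳ, δ)`: `(liftH G, P - δ)` and `(liftH G, ρ - δ)`;
* `Khovanskii.card_expSubSys_contactSys_lt`, `card_expSubSys_sphereSys_lt` — **both auxiliary
  systems have fewer exponential subterms than `F`** (every exponential subterm of them is a
  relabelling of one of `F` other than `e`).

Only syntax here (no real analysis); the semantics of these systems is in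
`KhovanskiiStep.lean`.

## References

* A. G. Khovanskii, *Fewnomials*, Transl. Math. Monogr. 88, AMS (1991), Ch. III. [Khovanskii1991]
* A. J. Wilkie, *On the theory of the real exponential field*, Illinois J. Math. 33 (1989), §5,
  Proposition (p. 402). [Wilkie1989]
-/

noncomputable section

open FirstOrder FirstOrder.Language FirstOrder.Language.Structure

namespace Literature.ModelTheory.ExponentialFields

namespace ExpTerm

variable {α : Type} [DecidableEq α]

/-- Exponential subterms of an exponential subterm are exponential subterms. [folklore] -/
theorem expSub_subset_of_mem {t e : Language.orderedExpRing.Term α} (he : e ∈ expSub t) :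
    expSub e ⊆ expSub t := by
  induction t with
  | var a => simp at he
  | func f ts ih =>
    cases f with
    | exp =>
      rw [expSub_func_exp, Finset.mem_insert, Finset.mem_biUnion] at he
      rcases he with rfl | ⟨i, -, hi⟩
      · exact le_rfl
      · exact (ih i hi).trans (expSub_arg_subset _ ts i)
    | _ =>
      rw [expSub, Finset.mem_biUnion] at he
      obtain ⟨i, -, hi⟩ := he
      exact (ih i hi).trans (expSub_arg_subset _ ts i)

/-- `expSub` of the formal partial derivative of a variable is empty. [folklore] -/
@[simp] theorem expSub_termPDeriv_var {κ ι : Type} [DecidableEq κ] [DecidableEq ι] (i : ι) (x : κ ⊕ ι) :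
    expSub (RealExpModel.termPDeriv i (var x : Language.orderedExpRing.Term (κ ⊕ ι))) = ∅ := by
  rcases x with c | j
  · simp
  · by_cases h : j = i
    · subst h; simp
    · rw [RealExpModel.termPDeriv_var_inr_of_ne i j h]; simp

end ExpTerm

namespace Khovanskii

open ExpTerm RealExpModel

variable {m N : ℕ}

/-! ### Systems and their exponential subterms -/

/-- The exponential subterms of a system of terms. [folklore] -/
def expSubSys {κ : Type} [DecidableEq κ] {n p : ℕ}
    (F : Fin p → Language.orderedExpRing.Term (κ ⊕ Fin n)) :
    Finset (Language.orderedExpRing.Term (κ ⊕ Fin n)) :=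
  Finset.univ.biUnion fun r => expSub (F r)

/-- Each member's exponential subterms belong to the system's. [folklore] -/
theorem expSub_subset_expSubSys {κ : Type} [DecidableEq κ] {n p : ℕ}
    (F : Fin p → Language.orderedExpRing.Term (κ ⊕ Fin n)) (r : Fin p) :
    expSub (F r) ⊆ expSubSys F :=
  Finset.subset_biUnion_of_mem (fun r => expSub (F r)) (Finset.mem_univ r)

/-! ### Stage 1: replacing the exponential `e` by a new unknown -/

/-- The embedding of the unknowns `x₁, …, x_N` among `x₁, …, x_{N+1}` (parameters unchanged).
[folklore] -/
def iota (m N : ℕ) : Fin m ⊕ Fin N → Fin m ⊕ Fin (N + 1) := Sum.map _root_.id Fin.castSucc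

/-- The new unknown `y = x_{N+1}` as a term. [folklore] -/
def yVar (m N : ℕ) : Language.orderedExpRing.Term (Fin m ⊕ Fin (N + 1)) :=
  var (Sum.inr (Fin.last N))

/-- **Stage 1.** The system `F` with the subterm `e` replaced by the new unknown `y`
(Khovanskii: `F(x, e^{s}) ↦ F(x, y)`). [cite: Khovanskii1991, Ch. III] -/
def elimF (F : Fin N → Language.orderedExpRing.Term (Fin m ⊕ Fin N))
    (e : Language.orderedExpRing.Term (Fin m ⊕ Fin N)) :
    Fin N → Language.orderedExpRing.Term (Fin m ⊕ Fin (N + 1)) :=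
  fun r => substExp e (yVar m N) (iota m N) (F r)

/-- The Jacobian matrix of terms `(∂Gᵣ/∂xⱼ)` of a system of `N` terms in `N + 1` unknowns.
[folklore] -/
def jac (G : Fin N → Language.orderedExpRing.Term (Fin m ⊕ Fin (N + 1))) :
    Matrix (Fin N) (Fin (N + 1)) (Language.orderedExpRing.Term (Fin m ⊕ Fin (N + 1))) :=
  Matrix.of fun r c => termPDeriv c (G r)

/-- The maximal minor of the Jacobian with column `c` deleted, as a term. [folklore] -/
def minorT (G : Fin N → Language.orderedExpRing.Term (Fin m ⊕ Fin (N + 1))) (c : Fin (N + 1)) :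
    Language.orderedExpRing.Term (Fin m ⊕ Fin (N + 1)) :=
  ExpTerm.det ((jac G).submatrix _root_.id c.succAbove)

/-- **The sum of the squares of the maximal minors** of the Jacobian of `G`. [folklore] -/
def minorSq (G : Fin N → Language.orderedExpRing.Term (Fin m ⊕ Fin (N + 1))) :
    Language.orderedExpRing.Term (Fin m ⊕ Fin (N + 1)) :=
  ExpTerm.sum fun c : Fin (N + 1) => minorT G c * minorT G c

/-! ### Stage 2: the Rabinowitsch lift and the contact / sphere systems -/

/-- **Stage 2.** The lifted system `G₁, …, G_N, x_{N+2} · minorSq G - 1` in `N + 2` unknowns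
(`RealExpModel.liftSys`, the trick of Wilkie 1989, p. 396). [cite: Wilkie1989, proof of Lemma 3, p. 396] -/
def liftH (G : Fin N → Language.orderedExpRing.Term (Fin m ⊕ Fin (N + 1))) :
    Fin (N + 1) → Language.orderedExpRing.Term (Fin m ⊕ Fin (N + 2)) :=
  liftSys G (minorSq G)

/-- The Jacobian matrix of terms of the lifted system (all `N + 2` unknowns). [folklore] -/
def jacH (G : Fin N → Language.orderedExpRing.Term (Fin m ⊕ Fin (N + 1))) :
    Matrix (Fin (N + 1)) (Fin (N + 2)) (Language.orderedExpRing.Term (Fin m ⊕ Fin (N + 2))) :=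
  Matrix.of fun r c => termPDeriv c (liftH G r)

/-- The unknown `y = x_{N+1}` among `x₁, …, x_{N+2}`. [folklore] -/
def yVar₂ (m N : ℕ) : Language.orderedExpRing.Term (Fin m ⊕ Fin (N + 2)) :=
  var (Sum.inr (Fin.last N).castSucc)

/-- The row of coefficients of the `1`-form `dy - y ds` in the unknowns `x₁, …, x_{N+2}`
(`s` a term in the original unknowns, lifted twice). [cite: Khovanskii1991, Ch. III] -/
def omegaRow (s : Language.orderedExpRing.Term (Fin m ⊕ Fin N)) :
    Fin (N + 2) → Language.orderedExpRing.Term (Fin m ⊕ Fin (N + 2)) :=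
  fun c => termPDeriv c (yVar₂ m N) + -(yVar₂ m N * termPDeriv c (liftTerm (liftTerm s)))

/-- **The contact term** `P = det [∂(liftH G)/∂x̄ ; dy - y ds]`: the pairing of `dy - y ds` with
the cross product of the gradient rows of the lifted system. [cite: Khovanskii1991, Ch. III] -/
def contactP (G : Fin N → Language.orderedExpRing.Term (Fin m ⊕ Fin (N + 1)))
    (s : Language.orderedExpRing.Term (Fin m ⊕ Fin N)) :
    Language.orderedExpRing.Term (Fin m ⊕ Fin (N + 2)) :=
  ExpTerm.det (Matrix.of (Fin.snoc (fun r => jacH G r) (omegaRow s) :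
    Fin (N + 2) → Fin (N + 2) → Language.orderedExpRing.Term (Fin m ⊕ Fin (N + 2))))

/-- The squared radius `Σⱼ xⱼ²` in the unknowns `x₁, …, x_{N+2}`. [folklore] -/
def rho (m N : ℕ) : Language.orderedExpRing.Term (Fin m ⊕ Fin (N + 2)) :=
  ExpTerm.sum fun c : Fin (N + 2) => var (Sum.inr c) * var (Sum.inr c)

/-- The embedding of the parameters `y₁, …, yₘ` among `y₁, …, y_{m+1}` (unknowns unchanged).
[folklore] -/
def kappa (m N : ℕ) : Fin m ⊕ Fin (N + 2) → Fin (m + 1) ⊕ Fin (N + 2) :=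
  Sum.map Fin.castSucc _root_.id

/-- The new parameter `y_{m+1}` (the level `δ`, resp. `R`) as a term. [folklore] -/
def pVar (m N : ℕ) : Language.orderedExpRing.Term (Fin (m + 1) ⊕ Fin (N + 2)) :=
  var (Sum.inl (Fin.last m))

/-- **The contact system** `(liftH G, P - δ)`: `N + 2` terms in `N + 2` unknowns, parameters
`(ȳ, δ)`. [cite: Khovanskii1991, Ch. III] -/
def contactSys (G : Fin N → Language.orderedExpRing.Term (Fin m ⊕ Fin (N + 1)))
    (s : Language.orderedExpRing.Term (Fin m ⊕ Fin N)) :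
    Fin (N + 2) → Language.orderedExpRing.Term (Fin (m + 1) ⊕ Fin (N + 2)) :=
  Fin.snoc (fun r => (liftH G r).relabel (kappa m N)) ((contactP G s).relabel (kappa m N) + -pVar m N)

/-- **The sphere system** `(liftH G, Σ xⱼ² - R)`: `N + 2` terms in `N + 2` unknowns, parameters
`(ȳ, R)`. [cite: Khovanskii1991, Ch. III] -/
def sphereSys (G : Fin N → Language.orderedExpRing.Term (Fin m ⊕ Fin (N + 1))) :
    Fin (N + 2) → Language.orderedExpRing.Term (Fin (m + 1) ⊕ Fin (N + 2)) :=
  Fin.snoc (fun r => (liftH G r).relabel (kappa m N)) ((rho m N).relabel (kappa m N) + -pVar m N)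

/-! ### Counting exponential subterms -/

section Count

/-- The total relabelling `(ȳ, x̄) ↦ (ȳ, x̄)` from `m ⊕ N` into `(m + 1) ⊕ (N + 2)`. [folklore] -/
def total (m N : ℕ) : Fin m ⊕ Fin N → Fin (m + 1) ⊕ Fin (N + 2) :=
  Sum.map Fin.castSucc fun j => (Fin.castSucc j).castSucc

/-- The lift map `x̄ ↦ x̄` from `N` into `N + 2` unknowns. [folklore] -/
def lift₂ (m N : ℕ) : Fin m ⊕ Fin N → Fin m ⊕ Fin (N + 2) :=
  Sum.map _root_.id fun j => (Fin.castSucc j).castSucc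

omit m N in
/-- Lifting twice is relabelling along `lift₂`. [folklore] -/
theorem liftTerm_liftTerm {m N : ℕ} (t : Language.orderedExpRing.Term (Fin m ⊕ Fin N)) :
    liftTerm (liftTerm t) = t.relabel (lift₂ m N) := by
  rw [liftTerm, liftTerm, Term.relabel_relabel]
  congr 1
  funext x
  rcases x with c | j <;> rfl

omit m N in
/-- Lifting after `iota` is relabelling along `lift₂`. [folklore] -/
theorem liftTerm_relabel_iota {m N : ℕ} (t : Language.orderedExpRing.Term (Fin m ⊕ Fin N)) :
    liftTerm (t.relabel (iota m N)) = t.relabel (lift₂ m N) := by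
  rw [liftTerm, Term.relabel_relabel]
  congr 1
  funext x
  rcases x with c | j <;> rfl

omit m N in
/-- `kappa ∘ lift₂ = total`. [folklore] -/
theorem kappa_comp_lift₂ {m N : ℕ} : kappa m N ∘ lift₂ m N = total m N := by
  funext x
  rcases x with c | j <;> rfl

omit m N in
/-- Lifting after `iota` is `lift₂` (as maps). [folklore] -/
theorem liftMap_comp_iota {m N : ℕ} :
    (Sum.map _root_.id Fin.castSucc : Fin m ⊕ Fin (N + 1) → Fin m ⊕ Fin (N + 2)) ∘ iota m N =
      lift₂ m N := by
  funext x
  rcases x with c | j <;> rfl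

variable (B : Finset (Language.orderedExpRing.Term (Fin m ⊕ Fin N)))
  (G : Fin N → Language.orderedExpRing.Term (Fin m ⊕ Fin (N + 1)))
  (s : Language.orderedExpRing.Term (Fin m ⊕ Fin N))

/-- Images of `B` under composite relabellings. [folklore] -/
theorem image_relabel_image_relabel {α β γ : Type} [DecidableEq β] [DecidableEq γ]
    (C : Finset (Language.orderedExpRing.Term α)) (f : α → β) (g : β → γ) :
    (C.image (Term.relabel f)).image (Term.relabel g) = C.image (Term.relabel (g ∘ f)) := by
  rw [Finset.image_image]
  congr 1
  funext t
  exact Term.relabel_relabel f g t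

/-- If the exponential subterms of each `Gᵣ` are relabellings along `iota` of members of `B`,
then those of the lifted system are relabellings along `lift₂` of members of `B`. [folklore] -/
theorem expSub_liftH_subset (hG : ∀ r, expSub (G r) ⊆ B.image (Term.relabel (iota m N)))
    (r : Fin (N + 1)) : expSub (liftH G r) ⊆ B.image (Term.relabel (lift₂ m N)) := by
  have hlift : ∀ t : Language.orderedExpRing.Term (Fin m ⊕ Fin (N + 1)),
      expSub t ⊆ B.image (Term.relabel (iota m N)) →
        expSub (liftTerm t) ⊆ B.image (Term.relabel (lift₂ m N)) := by
    intro t ht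
    rw [liftTerm, expSub_relabel]
    refine (Finset.image_subset_image ht).trans ?_
    rw [image_relabel_image_relabel, liftMap_comp_iota]
  -- the Jacobian entries, minors and `minorSq` stay within `B.image (relabel iota)`
  have hjac : ∀ r c, expSub (jac G r c) ⊆ B.image (Term.relabel (iota m N)) := fun r c =>
    (expSub_termPDeriv_subset c (G r)).trans (hG r)
  have hminor : ∀ c, expSub (minorT G c) ⊆ B.image (Term.relabel (iota m N)) := by
    intro c
    refine (expSub_det_subset _).trans ?_
    simp only [Finset.biUnion_subset_iff_forall_subset]
    intro ij _
    exact hjac _ _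
  have hsq : expSub (minorSq G) ⊆ B.image (Term.relabel (iota m N)) := by
    refine (expSub_sum_subset _).trans ?_
    simp only [Finset.biUnion_subset_iff_forall_subset]
    intro c _
    rw [expSub_mul]
    exact Finset.union_subset (hminor c) (hminor c)
  refine Fin.lastCases ?_ (fun r => ?_) r
  · -- the Rabinowitsch equation `x_{N+2} · minorSq - 1`
    show expSub (liftSys G (minorSq G) (Fin.last N)) ⊆ _
    simp only [liftSys, Fin.snoc_last, expSub_add, expSub_mul, expSub_var, expSub_neg, expSub_one,
      Finset.empty_union, Finset.union_empty]
    exact hlift _ hsq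
  · show expSub (liftSys G (minorSq G) (Fin.castSucc r)) ⊆ _
    simp only [liftSys, Fin.snoc_castSucc]
    exact hlift _ (hG r)

/-- The contact term's exponential subterms. [folklore] -/
theorem expSub_contactP_subset (hG : ∀ r, expSub (G r) ⊆ B.image (Term.relabel (iota m N)))
    (hs : expSub s ⊆ B) : expSub (contactP G s) ⊆ B.image (Term.relabel (lift₂ m N)) := by
  have hω : ∀ c, expSub (omegaRow s c) ⊆ B.image (Term.relabel (lift₂ m N)) := by
    intro c
    rw [omegaRow, expSub_add, expSub_neg, expSub_mul, yVar₂, expSub_termPDeriv_var, expSub_var,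
      Finset.empty_union, Finset.empty_union, liftTerm_liftTerm]
    refine (expSub_termPDeriv_subset c _).trans ?_
    rw [expSub_relabel]
    exact Finset.image_subset_image hs
  refine (expSub_det_subset _).trans ?_
  simp only [Finset.biUnion_subset_iff_forall_subset]
  rintro ⟨i, c⟩ -
  simp only [Matrix.of_apply]
  refine Fin.lastCases ?_ (fun r => ?_) i
  · rw [Fin.snoc_last]
    exact hω c
  · rw [Fin.snoc_castSucc, jacH, Matrix.of_apply]
    exact (expSub_termPDeriv_subset c _).trans (expSub_liftH_subset B G hG r)

/-- `rho` has no exponential subterms. [folklore] -/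
@[simp] theorem expSub_rho : expSub (rho m N) = ∅ := by
  rw [rho]
  refine Finset.subset_empty.1 ((expSub_sum_subset _).trans ?_)
  simp only [Finset.biUnion_subset_iff_forall_subset]
  intro c _
  simp

/-- **The contact system's exponential subterms are relabellings along `total` of members of
`B`.** [folklore] -/
theorem expSubSys_contactSys_subset (hG : ∀ r, expSub (G r) ⊆ B.image (Term.relabel (iota m N)))
    (hs : expSub s ⊆ B) : expSubSys (contactSys G s) ⊆ B.image (Term.relabel (total m N)) := by
  have hk : ∀ t : Language.orderedExpRing.Term (Fin m ⊕ Fin (N + 2)),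
      expSub t ⊆ B.image (Term.relabel (lift₂ m N)) →
        expSub (t.relabel (kappa m N)) ⊆ B.image (Term.relabel (total m N)) := by
    intro t ht
    rw [expSub_relabel]
    refine (Finset.image_subset_image ht).trans ?_
    rw [image_relabel_image_relabel, kappa_comp_lift₂]
  rw [expSubSys]
  simp only [Finset.biUnion_subset_iff_forall_subset]
  intro r _
  refine Fin.lastCases ?_ (fun r => ?_) r
  · rw [contactSys, Fin.snoc_last, expSub_add, expSub_neg, pVar, expSub_var, Finset.union_empty]
    exact hk _ (expSub_contactP_subset B G s hG hs)
  · rw [contactSys, Fin.snoc_castSucc]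
    exact hk _ (expSub_liftH_subset B G hG r)

/-- **The sphere system's exponential subterms are relabellings along `total` of members of
`B`.** [folklore] -/
theorem expSubSys_sphereSys_subset (hG : ∀ r, expSub (G r) ⊆ B.image (Term.relabel (iota m N))) :
    expSubSys (sphereSys G) ⊆ B.image (Term.relabel (total m N)) := by
  have hk : ∀ t : Language.orderedExpRing.Term (Fin m ⊕ Fin (N + 2)),
      expSub t ⊆ B.image (Term.relabel (lift₂ m N)) →
        expSub (t.relabel (kappa m N)) ⊆ B.image (Term.relabel (total m N)) := by
    intro t ht
    rw [expSub_relabel]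
    refine (Finset.image_subset_image ht).trans ?_
    rw [image_relabel_image_relabel, kappa_comp_lift₂]
  rw [expSubSys]
  simp only [Finset.biUnion_subset_iff_forall_subset]
  intro r _
  refine Fin.lastCases ?_ (fun r => ?_) r
  · rw [sphereSys, Fin.snoc_last, expSub_add, expSub_neg, pVar, expSub_var, Finset.union_empty,
      expSub_relabel, expSub_rho, Finset.image_empty]
    exact Finset.empty_subset _
  · rw [sphereSys, Fin.snoc_castSucc]
    exact hk _ (expSub_liftH_subset B G hG r)

end Count

/-! ### The step: an exponential of maximal size -/

section Step

variable (F : Fin N → Language.orderedExpRing.Term (Fin m ⊕ Fin N))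
  (es : Fin 1 → Language.orderedExpRing.Term (Fin m ⊕ Fin N))

/-- For `e = exp(s)` in the system with maximal size: the exponential subterms of the stage-1
system are relabellings of those of `F` other than `e`. [folklore] -/
theorem expSub_elimF_subset (hmax : ∀ e' ∈ expSubSys F, tsize e' ≤ tsize (func expRingFunc.exp es))
    (r : Fin N) :
    expSub (elimF F (func expRingFunc.exp es) r) ⊆
      ((expSubSys F).erase (func expRingFunc.exp es)).image (Term.relabel (iota m N)) := by
  refine (expSub_substExp_subset es (yVar m N) (by rw [yVar, expSub_var]) (iota m N)
    fun e' he' => hmax e' (expSub_subset_expSubSys F r he')).trans ?_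
  exact Finset.image_subset_image (Finset.erase_subset_erase _ (expSub_subset_expSubSys F r))

/-- The argument `s` of a member `exp(s)` of the system has its exponential subterms in the system,
and they differ from `exp(s)`. [folklore] -/
theorem expSub_arg_subset_erase (he : func expRingFunc.exp es ∈ expSubSys F) :
    expSub (es 0) ⊆ (expSubSys F).erase (func expRingFunc.exp es) := by
  intro x hx
  rw [Finset.mem_erase]
  refine ⟨fun hxe => ?_, ?_⟩
  · have := tsize_lt_of_mem_expSub_arg es hx
    rw [hxe] at this
    exact lt_irrefl _ this
  · rw [expSubSys, Finset.mem_biUnion] at he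
    obtain ⟨r, -, hr⟩ := he
    have h1 : expSub (es 0) ⊆ expSub (func expRingFunc.exp es : Language.orderedExpRing.Term _) :=
      expSub_arg_subset _ es 0
    exact expSub_subset_expSubSys F r ((h1.trans (expSub_subset_of_mem hr)) hx)

/-- **The contact system has fewer exponential subterms than `F`.** [cite: Khovanskii1991, Ch. III] -/
theorem card_expSubSys_contactSys_lt (he : func expRingFunc.exp es ∈ expSubSys F)
    (hmax : ∀ e' ∈ expSubSys F, tsize e' ≤ tsize (func expRingFunc.exp es)) :
    (expSubSys (contactSys (elimF F (func expRingFunc.exp es)) (es 0))).card < (expSubSys F).card := by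
  calc (expSubSys (contactSys (elimF F (func expRingFunc.exp es)) (es 0))).card
      ≤ (((expSubSys F).erase (func expRingFunc.exp es)).image (Term.relabel (total m N))).card :=
        Finset.card_le_card (expSubSys_contactSys_subset _ _ _ (expSub_elimF_subset F es hmax)
          (expSub_arg_subset_erase F es he))
    _ ≤ ((expSubSys F).erase (func expRingFunc.exp es)).card := Finset.card_image_le
    _ < (expSubSys F).card := Finset.card_erase_lt_of_mem he

/-- **The sphere system has fewer exponential subterms than `F`.** [cite: Khovanskii1991, Ch. III] -/
theorem card_expSubSys_sphereSys_lt (he : func expRingFunc.exp es ∈ expSubSys F)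
    (hmax : ∀ e' ∈ expSubSys F, tsize e' ≤ tsize (func expRingFunc.exp es)) :
    (expSubSys (sphereSys (elimF F (func expRingFunc.exp es)))).card < (expSubSys F).card := by
  calc (expSubSys (sphereSys (elimF F (func expRingFunc.exp es)))).card
      ≤ (((expSubSys F).erase (func expRingFunc.exp es)).image (Term.relabel (total m N))).card :=
        Finset.card_le_card (expSubSys_sphereSys_subset _ _ (expSub_elimF_subset F es hmax))
    _ ≤ ((expSubSys F).erase (func expRingFunc.exp es)).card := Finset.card_image_le
    _ < (expSubSys F).card := Finset.card_erase_lt_of_mem he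

end Step

end Khovanskii

end Literature.ModelTheory.ExponentialFields
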